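import Mathlib.NumberTheory.Padics.RingHoms
import Mathlib.Algebra.Ring.AddAut
import HarnessLib

/-!
# Sequential inverse limits of abelian groups and `ℤ_ℓ = lim ℤ/ℓᵐ`

Elementary algebra used to pass from finite-coefficient statements `Hⁱ(X, ℤ/ℓᵐ)` to `ℓ`-adic
statements `Hⁱ(X, ℤ_ℓ) := lim_m Hⁱ(X, ℤ/ℓᵐ)` (Milne, *Étale cohomology*, V §1):

* `Literature.Algebra.InverseSystem.addInverseLimit t`: the inverse limit `lim_m G m` of an
  `ℕ`-indexed inverse system of abelian groups with transition maps `t m : G (m + 1) →+ G m`,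
  realised as the subgroup of compatible families in `Π m, G m`; projections `proj`, the
  universal map `lift`, functoriality `map` and `congr` (compatible isomorphisms of systems give
  isomorphic limits).
* `Literature.Algebra.InverseSystem.padicIntAddEquiv`: `ℤ_[p] ≃+ lim_m ℤ/pᵐ` for the reduction
  maps (Mathlib's `PadicInt.toZModPow`, `PadicInt.ext_of_toZModPow`, `PadicInt.ofIntSeq`).
* `Literature.Algebra.InverseSystem.nonempty_addEquiv_padicInt_of_surjective`: if every `G m` is
  (abstractly) isomorphic to `ℤ/pᵐ` and all transition maps are surjective, then
  `lim_m G m ≃+ ℤ_[p]` — whatever the transition maps are. (Proof: choose a compatible sequence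
  of generators, starting from a generator in level `1` and lifting along the surjections; an
  element of `ℤ/pᵐ⁺¹` lifting a generator of `ℤ/pᵐ`, `m ≥ 1`, is a generator.)

All statements here are proved; there are no named facts in this file.

## Design notes

* We do not use Mathlib's categorical limits (`AddCommGrpCat`), to keep the comparison maps
  concrete (`≃+`); Mathlib has direct limits of modules/groups (`Module.DirectLimit`,
  `DirectedSystem`) and the abstract `InverseSystem` of `Mathlib.Order.DirectedInverseSystem`, but
  no bundled inverse limit of groups (searched `InverseLimit`, `invLim`, `InverseSystem.limit`).
* Prior art in the tree: `Literature.NumberTheory.EllipticCurves.compatSeqSubring p`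
  (`TateModuleProofs.lean`: the subring of `Π_k ℤ/pᵏ` of all-pairs compatible sequences — the
  same carrier as `zmodPowLimit p` — with `toPadicInt : compatSeqSubring p →+* ℤ_[p]` via
  `PadicInt.lift`), and `Literature.AlgebraicGeometry.Motives.towerLim f`
  (`Motives/EllAdicComparison.lean`: the limit of a tower as the kernel of
  `(a_m) ↦ (a_m - f_m a_{m+1})`, with `mem_towerLim_iff` giving the same carrier as
  `addInverseLimit f`; that file also has `lim¹`). The present file is the generic additive-group
  version with the comparison API (`lift`/`map`/`congr`) and the two `ℤ_[p]` results, which the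
  others lack; `towerLim f = addInverseLimit f` as subgroups is a one-line `AddSubgroup.ext`.
* The API of `addInverseLimit` is grouped in `namespace addInverseLimit` (`addInverseLimit.proj`,
  `.lift`, `.map`, `.congr`, …) to keep the directory namespace free of generic names; the
  helpers of the last section are `private`.
* Indexing starts at `m = 0` (`G 0` is typically trivial, e.g. `ℤ/p⁰`); no `ℕ`-subtraction occurs.
-/

namespace Literature.Algebra.InverseSystem

universe u v

open Function

section General

variable {G : ℕ → Type u} [∀ m, AddCommGroup (G m)] (t : ∀ m, G (m + 1) →+ G m)

/-- The **inverse limit** `lim_m G m` of the inverse system `⋯ → G (m+1) —t m→ G m → ⋯ → G 0` of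
abelian groups: the subgroup of `Π m, G m` of families `x` with `t m (x (m + 1)) = x m` for all
`m` (Milne, *Étale cohomology*, V §1, `H^r(X, F) = lim H^r(X, F_n)`; Atiyah–Macdonald Ch. 10).
[folklore] -/
def addInverseLimit : AddSubgroup (∀ m, G m) where
  carrier := {x | ∀ m, t m (x (m + 1)) = x m}
  add_mem' {x y} hx hy m := by simp only [Pi.add_apply, map_add, hx m, hy m]
  zero_mem' m := by simp
  neg_mem' {x} hx m := by simp only [Pi.neg_apply, map_neg, hx m]

variable {t} in
/-- Membership in the inverse limit is compatibility with the transition maps. [folklore] -/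
theorem mem_addInverseLimit_iff (x : ∀ m, G m) :
    x ∈ addInverseLimit t ↔ ∀ m, t m (x (m + 1)) = x m :=
  Iff.rfl

namespace addInverseLimit

/-- The projection `lim_m G m →+ G m`. [folklore] -/
def proj (m : ℕ) : addInverseLimit t →+ G m :=
  (Pi.evalAddMonoidHom G m).comp (addInverseLimit t).subtype

/-- The `m`-th projection is the `m`-th coordinate (unfolding lemma). [folklore] -/
theorem proj_apply (m : ℕ) (x : addInverseLimit t) : proj t m x = (x : ∀ m, G m) m := rfl

/-- The projections are compatible with the transition maps. [folklore] -/
@[simp]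
theorem transition_proj_succ (m : ℕ) (x : addInverseLimit t) :
    t m (proj t (m + 1) x) = proj t m x :=
  x.2 m

variable {t} in
/-- Two elements of the inverse limit with the same projections are equal. [folklore] -/
@[ext]
theorem ext {x y : addInverseLimit t} (h : ∀ m, proj t m x = proj t m y) : x = y :=
  Subtype.ext (funext h)

section Lift

variable {A : Type v} [AddCommGroup A] (φ : ∀ m, A →+ G m)
  (hφ : ∀ m a, t m (φ (m + 1) a) = φ m a)

/-- The universal property: a compatible family of homomorphisms `φ m : A →+ G m` factors through
the inverse limit. [folklore] -/
def lift : A →+ addInverseLimit t where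
  toFun a := ⟨fun m ↦ φ m a, fun m ↦ hφ m a⟩
  map_zero' := Subtype.ext (funext fun m ↦ map_zero (φ m))
  map_add' a b := Subtype.ext (funext fun m ↦ map_add (φ m) a b)

/-- The universal map followed by the `m`-th projection is `φ m` (by `rfl`). [folklore] -/
@[simp]
theorem proj_lift (m : ℕ) (a : A) : proj t m (lift t φ hφ a) = φ m a := rfl

end Lift

section Map

variable {G' : ℕ → Type v} [∀ m, AddCommGroup (G' m)] (t' : ∀ m, G' (m + 1) →+ G' m)

/-- Functoriality: a morphism of inverse systems (homomorphisms `e m : G m →+ G' m` commuting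
with the transition maps) induces a homomorphism of inverse limits. [folklore] -/
def map (e : ∀ m, G m →+ G' m) (he : ∀ m x, t' m (e (m + 1) x) = e m (t m x)) :
    addInverseLimit t →+ addInverseLimit t' :=
  lift t' (fun m ↦ (e m).comp (proj t m)) fun m x ↦ by
    simp only [AddMonoidHom.coe_comp, comp_apply, he, transition_proj_succ]

/-- The induced map on limits followed by the `m`-th projection is `e m` after the `m`-th
projection (by `rfl`). [folklore] -/
@[simp]
theorem proj_map (e : ∀ m, G m →+ G' m) (he : ∀ m x, t' m (e (m + 1) x) = e m (t m x))
    (m : ℕ) (x : addInverseLimit t) : proj t' m (map t t' e he x) = e m (proj t m x) := rfl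

/-- Compatible isomorphisms of inverse systems induce an isomorphism of inverse limits.
[folklore] -/
def congr (e : ∀ m, G m ≃+ G' m) (he : ∀ m x, t' m (e (m + 1) x) = e m (t m x)) :
    addInverseLimit t ≃+ addInverseLimit t' where
  toFun := map t t' (fun m ↦ (e m).toAddMonoidHom) he
  invFun := map t' t (fun m ↦ (e m).symm.toAddMonoidHom) fun m y ↦ by
    apply (e m).injective
    simp only [AddEquiv.toAddMonoidHom_eq_coe, AddMonoidHom.coe_coe, AddEquiv.apply_symm_apply,
      ← he, AddEquiv.apply_symm_apply]
  left_inv x := by ext m; simp [proj_map]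
  right_inv y := by ext m; simp [proj_map]
  map_add' x y := map_add _ x y

/-- The induced isomorphism of limits followed by the `m`-th projection is `e m` after the
`m`-th projection (by `rfl`). [folklore] -/
@[simp]
theorem proj_congr (e : ∀ m, G m ≃+ G' m) (he : ∀ m x, t' m (e (m + 1) x) = e m (t m x))
    (m : ℕ) (x : addInverseLimit t) : proj t' m (congr t t' e he x) = e m (proj t m x) := rfl

end Map

end addInverseLimit

end General

/-! ### `ℤ_[p]` as the inverse limit of the `ℤ/pᵐ` -/

section Padic

variable (p : ℕ)

/-- The reduction maps `ℤ/pᵐ⁺¹ → ℤ/pᵐ` as additive homomorphisms: the transition maps of the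
inverse system `(ℤ/pᵐ)_m`. [folklore] -/
def zmodPowTransition (m : ℕ) : ZMod (p ^ (m + 1)) →+ ZMod (p ^ m) :=
  (ZMod.castHom (pow_dvd_pow p m.le_succ) (ZMod (p ^ m))).toAddMonoidHom

/-- The transition map `ℤ/pᵐ⁺¹ → ℤ/pᵐ` is `ZMod.cast` (unfolding lemma). [folklore] -/
@[simp]
theorem zmodPowTransition_apply (m : ℕ) (x : ZMod (p ^ (m + 1))) :
    zmodPowTransition p m x = (ZMod.cast x : ZMod (p ^ m)) := rfl

/-- The inverse limit `lim_m ℤ/pᵐ` along the reduction maps. [folklore] -/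
abbrev zmodPowLimit : AddSubgroup (∀ m, ZMod (p ^ m)) :=
  addInverseLimit (G := fun m ↦ ZMod (p ^ m)) (zmodPowTransition p)

variable [hp : Fact p.Prime]

/-- The canonical map `ℤ_[p] → lim_m ℤ/pᵐ`, `x ↦ (x mod pᵐ)_m` (Mathlib `PadicInt.toZModPow`).
[folklore] -/
noncomputable def padicIntToLimit : ℤ_[p] →+ zmodPowLimit p :=
  addInverseLimit.lift (G := fun m ↦ ZMod (p ^ m)) _ (fun m ↦ (PadicInt.toZModPow m).toAddMonoidHom) fun m x ↦ by
    simp [PadicInt.cast_toZModPow m (m + 1) m.le_succ]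

/-- The `m`-th component of the canonical map is reduction modulo `pᵐ` (by `rfl`). [folklore] -/
@[simp]
theorem proj_padicIntToLimit (m : ℕ) (x : ℤ_[p]) :
    addInverseLimit.proj (G := fun m ↦ ZMod (p ^ m)) _ m (padicIntToLimit p x) =
      PadicInt.toZModPow m x :=
  rfl

/-- `ℤ_[p] → lim_m ℤ/pᵐ` is injective: a `p`-adic integer is determined by its residues
(Mathlib `PadicInt.ext_of_toZModPow`). [folklore] -/
theorem padicIntToLimit_injective : Injective (padicIntToLimit p) := fun x y h ↦
  PadicInt.ext_of_toZModPow.1 fun m ↦ by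
    rw [← proj_padicIntToLimit, ← proj_padicIntToLimit, h]

/-- `ℤ_[p] → lim_m ℤ/pᵐ` is surjective: a compatible family of residues is the family of
residues of the `p`-adic limit of its canonical representatives (Mathlib `PadicInt.ofIntSeq`,
`PadicInt.toZModPow_ofIntSeq_of_pow_dvd_sub`). [folklore] -/
theorem padicIntToLimit_surjective : Surjective (padicIntToLimit p) := by
  intro y
  -- the integer sequence of canonical representatives is `p`-adically Cauchy
  let f : ℕ → ℤ := fun m ↦ ((addInverseLimit.proj (G := fun m ↦ ZMod (p ^ m)) _ m y).val : ℤ)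
  have hdvd : ∀ i, (p : ℤ) ^ i ∣ f (i + 1) - f i := fun i ↦ by
    have hc : (ZMod.cast (addInverseLimit.proj (G := fun m ↦ ZMod (p ^ m)) _ (i + 1) y) :
        ZMod (p ^ i)) = addInverseLimit.proj (G := fun m ↦ ZMod (p ^ m)) _ i y :=
      addInverseLimit.transition_proj_succ (G := fun m ↦ ZMod (p ^ m)) _ i y
    rw [ZMod.cast_eq_val] at hc
    show (p : ℤ) ^ i ∣ ((addInverseLimit.proj (G := fun m ↦ ZMod (p ^ m)) _ (i + 1) y).val : ℤ) -
      ((addInverseLimit.proj (G := fun m ↦ ZMod (p ^ m)) _ i y).val : ℤ)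
    rw [← Int.natCast_pow, ← ZMod.intCast_eq_intCast_iff_dvd_sub, Int.cast_natCast,
      Int.cast_natCast, hc, ZMod.natCast_zmod_val]
  refine ⟨PadicInt.ofIntSeq f (PadicInt.isCauSeq_padicNorm_of_pow_dvd_sub f p hdvd), ?_⟩
  ext m
  rw [proj_padicIntToLimit, PadicInt.toZModPow_ofIntSeq_of_pow_dvd_sub f p hdvd m]
  show (((addInverseLimit.proj (G := fun m ↦ ZMod (p ^ m)) _ m y).val : ℤ) : ZMod (p ^ m)) = _
  rw [Int.cast_natCast, ZMod.natCast_zmod_val]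

/-- **`ℤ_p = lim ℤ/pᵐ`**: the canonical isomorphism of additive groups between Mathlib's `ℤ_[p]`
and the inverse limit of the `ℤ/pᵐ` along the reduction maps (Milne, *Étale cohomology*, V §1,
"the ring `ℤ_l = lim ℤ/(lⁿ)`"). [folklore] -/
noncomputable def padicIntAddEquiv : ℤ_[p] ≃+ zmodPowLimit p :=
  AddEquiv.ofBijective (padicIntToLimit p) ⟨padicIntToLimit_injective p, padicIntToLimit_surjective p⟩

/-- The `m`-th component of `padicIntAddEquiv` is reduction modulo `pᵐ` (by `rfl`). [folklore] -/
@[simp]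
theorem proj_padicIntAddEquiv (m : ℕ) (x : ℤ_[p]) :
    addInverseLimit.proj (G := fun m ↦ ZMod (p ^ m)) _ m (padicIntAddEquiv p x) =
      PadicInt.toZModPow m x :=
  rfl

end Padic

/-! ### Inverse systems of cyclic groups of order `pᵐ` with surjective transition maps -/

section Cyclic

variable {p : ℕ} [hp : Fact p.Prime]

/-- An additive map out of `ℤ/n` into a ring is `x ↦ x̄ · f 1`. [folklore] -/
private theorem addMonoidHom_zmod_apply {n : ℕ} {R : Type v} [Ring R] (f : ZMod n →+ R) (x : ZMod n) :
    f x = (ZMod.cast x : R) * f 1 := by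
  conv_lhs => rw [← ZMod.intCast_zmod_cast x, ← zsmul_one ((ZMod.cast x : ℤ)), map_zsmul]
  rw [zsmul_eq_mul, ZMod.intCast_cast]

/-- A lift to `ℤ/pᵐ⁺²` of a unit of `ℤ/pᵐ⁺¹` is a unit (cf. the tree's
`isUnit_iff_isUnit_castHom` in `PAdicLFunctionInterpolationProofs.lean`, too heavy to import).
[folklore] -/
private theorem isUnit_of_isUnit_cast {m : ℕ} (x : ZMod (p ^ (m + 2)))
    (hx : IsUnit (ZMod.cast x : ZMod (p ^ (m + 1)))) : IsUnit x := by
  rw [ZMod.cast_eq_val, ZMod.isUnit_iff_coprime] at hx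
  rw [← ZMod.natCast_zmod_val x, ZMod.isUnit_iff_coprime]
  exact ((Nat.coprime_pow_right_iff m.succ_pos _ _).1 hx).pow_right _

variable {G : ℕ → Type u} [∀ m, AddCommGroup (G m)] {t : ∀ m, G (m + 1) →+ G m}

/-- A compatible sequence `y m ∈ G m` starting from a given `y₁ ∈ G 1`, obtained by successively
choosing preimages under the (surjective) transition maps; `y 0 := t 0 y₁`. [folklore] -/
private noncomputable def liftSeq (ht : ∀ m, Surjective (t m)) (y₁ : G 1) : ∀ m, G m
  | 0 => t 0 y₁
  | 1 => y₁
  | m + 2 => Classical.choose (ht (m + 1) (liftSeq ht y₁ (m + 1)))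

/-- The lifted sequence is compatible with the transition maps. [folklore] -/
private theorem transition_liftSeq (ht : ∀ m, Surjective (t m)) (y₁ : G 1) (m : ℕ) :
    t m (liftSeq ht y₁ (m + 1)) = liftSeq ht y₁ m := by
  cases m with
  | zero => rfl
  | succ m => exact Classical.choose_spec (ht (m + 1) (liftSeq ht y₁ (m + 1)))

/-- **Inverse limits of cyclic groups.** If every `G m` is isomorphic (as a group, by arbitrary
isomorphisms) to `ℤ/pᵐ` and all transition maps `t m : G (m+1) → G m` are surjective, then
`lim_m G m ≃+ ℤ_[p]`. Proof: choose `y₁` a generator of `G 1` and lift it to a compatible sequence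
`y m` (`liftSeq`); read in `ℤ/pᵐ`, `y m` is a unit for every `m` (a lift of a unit is a unit), so
`x ↦ x · y m` (Mathlib `AddAut.mulRight`) are compatible isomorphisms `ℤ/pᵐ ≃ G m`, and
`lim ℤ/pᵐ = ℤ_p` (`padicIntAddEquiv`). [folklore] -/
theorem nonempty_addEquiv_padicInt_of_surjective (e : ∀ m, G m ≃+ ZMod (p ^ m))
    (ht : ∀ m, Surjective (t m)) : Nonempty (addInverseLimit t ≃+ ℤ_[p]) := by
  -- the transition maps read in `ℤ/pᵐ`
  let s : ∀ m, ZMod (p ^ (m + 1)) →+ ZMod (p ^ m) :=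
    fun m ↦ ((e m).toAddMonoidHom.comp (t m)).comp (e (m + 1)).symm.toAddMonoidHom
  have hs : ∀ m x, s m (e (m + 1) x) = e m (t m x) := fun m x ↦ by simp [s]
  -- a compatible sequence of generators
  let y : ∀ m, G m := liftSeq ht ((e 1).symm 1)
  let z : ∀ m, ZMod (p ^ m) := fun m ↦ e m (y m)
  have hz : ∀ m, s m (z (m + 1)) = z m := fun m ↦ by
    simp only [z, hs, y, transition_liftSeq]
  have hzu : ∀ m, IsUnit (z m) := by
    intro m
    induction m with
    | zero =>
      haveI : Subsingleton (ZMod (p ^ 0)) := by rw [pow_zero]; infer_instance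
      exact isUnit_of_subsingleton _
    | succ m ih =>
      cases m with
      | zero => simp [z, y, liftSeq]
      | succ m =>
        have h1 : IsUnit ((ZMod.cast (z (m + 2)) : ZMod (p ^ (m + 1))) * s (m + 1) 1) := by
          rw [← addMonoidHom_zmod_apply, hz]
          exact ih
        exact isUnit_of_isUnit_cast _ (isUnit_of_mul_isUnit_left h1)
  -- compatible isomorphisms `ℤ/pᵐ ≃+ G m`, `x ↦ (e m)⁻¹ (x · z m)`
  let φ : ∀ m, ZMod (p ^ m) ≃+ G m := fun m ↦ (AddAut.mulRight (hzu m).unit).trans (e m).symm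
  have hφ : ∀ m x, t m (φ (m + 1) x) = φ m (zmodPowTransition p m x) := fun m x ↦ by
    apply (e m).injective
    simp only [φ, AddEquiv.trans_apply, AddAut.mulRight_apply, IsUnit.unit_spec,
      AddEquiv.apply_symm_apply, zmodPowTransition_apply, ← hs]
    rw [addMonoidHom_zmod_apply, ZMod.cast_mul (pow_dvd_pow p m.le_succ), mul_assoc,
      ← addMonoidHom_zmod_apply, hz]
  exact ⟨((padicIntAddEquiv p).trans
    (addInverseLimit.congr (G := fun m ↦ ZMod (p ^ m)) _ _ φ hφ)).symm⟩

end Cyclic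

end Literature.Algebra.InverseSystem
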